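import Summits.KontsevichZagierPeriods.Zeta5Search.Barrier.ConeGammaRates

/-!
# ζ(5) search — BARRIER: a lossy direction for the `S₇` generator `s₅ ↔ s₆` inside the cone (witness)

HONEST FRAMING (cell `pub-zeta5`): systematic search; no irrationality claim unless kernel-certified. MODEL objects
under Brown–Zudilin's (28)+(30) accounting ([BZ22] = arXiv:2210.03391; (28) observed, not proved); an explicit
rational computation about BZ's §5 critical system; nothing here is about the size of any critical value, the
cone's supremum (C2 = `BarrierC2`, OPEN), S-E (CONJECTURED) or `ζ(5)`. No number or sentence of record moves.
Records in print UNMOVED. Prover P2 g21 (self-selected Lean-only item, file 6).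

The files `ConeGammaS7CritSwap` / `ConeGammaS7CritOrbit` prove the critical-value cocycle under the hypergeometric
group for the Möbius generator `(56)` only at LOSS-FREE critical points (`y′ = y − s₆ + s₅ ≠ 0`, `Q₅ ≠ 0`). This
file shows that the exception is REAL and sits INSIDE the cone:
* `not_isCritical_zero_snd`, `not_isCritical_zero_fst` — BZ's trivial solutions are never critical: no critical
  point has `y = 0` (or `x = 0`), for any direction;
* **`witness_isCritical`** — the INTEGER direction `a = (19, 18, 11, 15, 9, 6, 7, 12)` (symmetric parameters
  `s = (22; 15, 4, 7, 2, 5, 1, 6)`, census class `44; 2,4,8,10,12,14,30` up to `S₇`) has the RATIONAL critical point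
  `(x, y) = (−27, −4)` (all twelve factors are non-zero integers);
* `witness_mem_BZCone`, `witness_openBox` — `a` lies in BZ's cone, strictly inside the box;
* **`witness_lossy`** — at this point `y − s₆ + s₅ = 0`: its Möbius image under `(56)` is the trivial solution
  `(p₃′, 0)` of the swapped direction, which is NOT critical (`not_isCritical_zero_snd`); hence
  `witness_not_nondegenerate` — the loss-free hypothesis of `critVals_permAct_of_nondegenerate` FAILS at `a`.
NUMERICS (not claimed in the kernel; seat folder `scratch/verify_witness.py`, stdlib Newton from 3,000 starts): at
the half-scale `s/2` the critical values of `a` are `{−28.2392, −16.7101, 35.5842}` (three: `Regular`), the lost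
one `−16.7101` being the value at `(−27, −4)/2` — the MIDDLE one, `C₀(a)`; the swapped direction `(56)·a` has only
`{−28.2392, 35.5842} + ΔE`, `ΔE = −1.18494` (Newton finds the degenerate cluster at `(p₃′, 0)` instead): so at `a`
the set cocycle `critVals((56)·a) = critVals(a) + ΔE` and the `S₇`-invariance of `Regular` FAIL, and the
hypothesis `hcrit` of `coneSupBound_iff_sorted_of_critShift` (P2 g20, stated for ALL `a ∈ BZCone`) is not
satisfiable as stated — the `S₇` reduction of the barrier statement holds off such codimension-one loci only.
-/

noncomputable section

namespace Summit.KontsevichZagierPeriods.Zeta5Search.Barrier.ConeGamma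

/-- **No critical point has `y = 0`**: there `F₂ = −v₃v₇v₈v₉ ≠ 0` (BZ's trivial solution `(p₃, 0)` of (19) is
excluded by the non-vanishing of the twelve factors). -/
theorem not_isCritical_zero_snd (a : Dir) (x : ℝ) : ¬ IsCritical a x 0 := by
  rintro ⟨_, hF2, hv⟩
  have h3 := hv 3; have h7 := hv 7; have h8 := hv 8; have h9 := hv 9
  simp only [critFactors, Matrix.cons_val] at h3 h7 h8 h9
  apply mul_ne_zero (mul_ne_zero (mul_ne_zero h3 h7) h8) h9
  simp only [F2R] at hF2
  linear_combination -hF2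

/-- **No critical point has `x = 0`**: there `F₁ = −v₀v₁v₂v₃ ≠ 0`. -/
theorem not_isCritical_zero_fst (a : Dir) (y : ℝ) : ¬ IsCritical a 0 y := by
  rintro ⟨hF1, _, hv⟩
  have h0 := hv 0; have h1 := hv 1; have h2 := hv 2; have h3 := hv 3
  simp only [critFactors, Matrix.cons_val] at h0 h1 h2 h3
  apply mul_ne_zero (mul_ne_zero (mul_ne_zero h0 h1) h2) h3
  simp only [F1R] at hF1
  linear_combination -hF1

/-- The symmetric parameters of the witness: `s = (22; 15, 4, 7, 2, 5, 1, 6)`. -/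
theorem witness_sParam :
    sParam (![19, 18, 11, 15, 9, 6, 7, 12] : Dir) = ![22, 15, 4, 7, 2, 5, 1, 6] := by
  ext i; fin_cases i <;> simp [sParam] <;> norm_num

/-- The witness direction lies in BZ's cone (closed box and the non-voidness margin). -/
theorem witness_mem_BZCone : (![19, 18, 11, 15, 9, 6, 7, 12] : Dir) ∈ BZCone := by
  refine ⟨⟨?_, fun j => ?_⟩, ?_⟩
  · rw [witness_sParam]; simp
  · rw [witness_sParam]; fin_cases j <;> simp <;> norm_num
  · rw [witness_sParam]; simp [Fin.sum_univ_succ]; norm_num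

/-- The witness direction lies strictly inside the box: `0 < sⱼ < s₀`. -/
theorem witness_openBox (j : Fin 7) :
    0 < sParam (![19, 18, 11, 15, 9, 6, 7, 12] : Dir) j.succ
    ∧ sParam (![19, 18, 11, 15, 9, 6, 7, 12] : Dir) j.succ < sParam (![19, 18, 11, 15, 9, 6, 7, 12] : Dir) 0 := by
  rw [witness_sParam]; fin_cases j <;> simp <;> norm_num

/-- **The witness direction has the rational critical point `(−27, −4)`** (`(p;q) = (3,8,6,23,7,5,16; 15,9,17,19,18)`;
the twelve factors are `−30, −35, −33, −54, 50, 42, −33, −11, −9, −20, 30, 27`). -/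
theorem witness_isCritical : IsCritical (![19, 18, 11, 15, 9, 6, 7, 12] : Dir) (-27) (-4) := by
  refine ⟨?_, ?_, fun k => ?_⟩
  · simp [F1R, pR, qR]; norm_num
  · simp [F2R, pR, qR]; norm_num
  · fin_cases k <;> simp [critFactors, pR, qR] <;> norm_num

/-- **The critical point `(−27, −4)` is LOSSY for `(56)`**: `y − s₆ + s₅ = 0`, i.e. its Möbius image is BZ's trivial
solution `(p₃′, 0)` of the swapped direction. -/
theorem witness_lossy :
    (-4 : ℝ) - sParam (![19, 18, 11, 15, 9, 6, 7, 12] : Dir) 6 + sParam (![19, 18, 11, 15, 9, 6, 7, 12] : Dir) 5 = 0 := by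
  rw [witness_sParam]; simp; norm_num

/-- **The loss-free hypothesis fails inside the cone**: there is a direction of BZ's cone, strictly inside the box,
with a critical point whose `(56)`-image is the (never critical) trivial solution — so the hypothesis `hN` of
`critVals_permAct_of_nondegenerate` (file `ConeGammaS7CritOrbit`) is violated at `g = 1` there. -/
theorem exists_mem_BZCone_lossy :
    ∃ a : Dir, a ∈ BZCone ∧ (∀ j : Fin 7, 0 < sParam a j.succ ∧ sParam a j.succ < sParam a 0)
      ∧ ∃ x y : ℝ, IsCritical a x y ∧ y - sParam a 6 + sParam a 5 = 0 :=
  ⟨_, witness_mem_BZCone, witness_openBox, -27, -4, witness_isCritical, witness_lossy⟩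

end Summit.KontsevichZagierPeriods.Zeta5Search.Barrier.ConeGamma

end
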